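import Mathlib
import Summits.NavierStokesRegularity.NavierStokesRegularity.Theorems.EulerZoomLiouvillePowerGaugeEulerLiouvilleGalileanFrameShear
import HarnessLib

/-!
# Crux E `PowerGaugeEulerLiouville` (stmt-NavierStokesRegularity-19832), line `galilean-frames` (ns-idea-11 g6), stub F1e
# `stub_frameSteadyEscaping` — tools II: PAIRINGS IN A MOVING FRAME ARE `C¹` / CONTINUOUS IN TIME (width seat ns-ezl-w3 g5)

Route №10 `EulerZoomLiouville` (NavierStokesRegularity), crux E.  For a locally integrable profile `U` on `ℝ³`, a test field `Φ`, a
continuous compactly supported operator field `Ψ` and a `C¹` frame path `ξ`: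

* `hasDerivAt_integral_inner_comp_add_path` — `τ ↦ ∫ ⟪U, Φ(· + ξ(τ))⟫` has derivative `∫ ⟪U, DΦ(· + ξ(τ)) ξ'(τ)⟫` (dominated
  differentiation under the integral sign) — this is why the line's F1e needs NO co-moving test fields and NO time mollification;
* `continuous_integral_inner_clm_comp_add_path` — `τ ↦ ∫ ⟪U, Ψ(· + ξ(τ)) c(τ)⟫` is continuous (`c` continuous);
* `continuous_integral_inner_clm_comp_add_path_self` — `τ ↦ ∫ ⟪U, Ψ(· + ξ(τ)) U⟫` is continuous (`|U|² ∈ L¹_loc`).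

WHAT THIS IS NOT: not NS regularity, not the crux E — tools for one stratum of the crux CLASS 19832 (MODEL lattice; E/NS strata),
`--supports` stmt-19832; 19832 OPEN. [folklore]
-/

noncomputable section

-- flat `Theorems/<Route><Decl>…` files of one crux share the namespace of the crux (tree convention: `Summit.<S>.<S>.…`)
set_option linter.dupNamespace false

open MeasureTheory Set Filter Topology Metric Function TopologicalSpace InnerProductSpace
open scoped ENNReal NNReal RealInnerProductSpace ContDiff

namespace Summit.NavierStokesRegularity.NavierStokesRegularity.Theorems.PowerGaugeEulerLiouville

namespace GalileanFrames

open Literature.Analysis Literature.Analysis.FunctionSpaces Literature.Analysis.FluidPDE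
open Summit.NavierStokesRegularity.NavierStokesRegularity.Theorems.PowerGaugeEulerLiouville

variable {U : EuclideanSpace ℝ (Fin 3) → EuclideanSpace ℝ (Fin 3)} {ξ : ℝ → EuclideanSpace ℝ (Fin 3)}

/-! ### The pairings in the moving frame: continuity and differentiability in time -/

/-- **Dominated differentiation of the frame pairing.**  For `U ∈ L¹_loc`, a test field `Φ` and a `C¹` path `ξ`, the pairing
`f(τ) = ∫ ⟪U(z), Φ(z + ξ(τ))⟫ dz` has derivative `∫ ⟪U(z), DΦ(z + ξ(τ)) ξ'(τ)⟫ dz` at every `τ`. [folklore] -/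
theorem hasDerivAt_integral_inner_comp_add_path (hU : LocallyIntegrable U volume) (hξ : ContDiff ℝ 1 ξ)
    {Φ : EuclideanSpace ℝ (Fin 3) → EuclideanSpace ℝ (Fin 3)} (hΦ : IsTestFunctionOn (⊤ : Opens (EuclideanSpace ℝ (Fin 3))) Φ)
    (τ₀ : ℝ) :
    HasDerivAt (fun τ : ℝ => ∫ z, ⟪U z, Φ (z + ξ τ)⟫) (∫ z, ⟪U z, (fderiv ℝ Φ (z + ξ τ₀)) (deriv ξ τ₀)⟫) τ₀ := by
  have hΦc : Continuous Φ := hΦ.contDiff.continuous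
  have hΦd : Differentiable ℝ Φ := hΦ.contDiff.differentiable (by simp)
  have hDΦc : Continuous (fderiv ℝ Φ) := hΦ.contDiff.continuous_fderiv (by simp)
  have hDΦs : HasCompactSupport (fderiv ℝ Φ) := hΦ.hasCompactSupport.fderiv (𝕜 := ℝ)
  have hξc : Continuous ξ := hξ.continuous
  have hξd : Differentiable ℝ ξ := hξ.differentiable (by simp)
  have hξ'c : Continuous (deriv ξ) := hξ.continuous_deriv le_rfl
  obtain ⟨M₁, hM₁⟩ := hDΦc.bounded_above_of_compact_support hDΦs
  have hM₁0 : 0 ≤ M₁ := (norm_nonneg _).trans (hM₁ 0)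
  obtain ⟨R₀, hR₀⟩ := (hΦ.hasCompactSupport.isCompact.isBounded).subset_closedBall (0 : EuclideanSpace ℝ (Fin 3))
  -- bounds for `ξ` and `ξ'` on the time window `[τ₀ − 1, τ₀ + 1]`
  obtain ⟨Mξ, hMξ⟩ := (isCompact_Icc (a := τ₀ - 1) (b := τ₀ + 1)).exists_bound_of_continuousOn hξc.continuousOn
  obtain ⟨Mξ', hMξ'⟩ := (isCompact_Icc (a := τ₀ - 1) (b := τ₀ + 1)).exists_bound_of_continuousOn hξ'c.continuousOn
  have hMξ'0 : 0 ≤ Mξ' := (norm_nonneg _).trans (hMξ' τ₀ ⟨by linarith, by linarith⟩)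
  have hball : ∀ t ∈ ball τ₀ (1 : ℝ), t ∈ Icc (τ₀ - 1) (τ₀ + 1) := fun t ht => by
    have h := mem_ball_iff_norm.1 ht
    rw [Real.norm_eq_abs, abs_lt] at h
    exact ⟨by linarith, by linarith⟩
  set F' : ℝ → EuclideanSpace ℝ (Fin 3) → ℝ := fun t z => ⟪U z, (fderiv ℝ Φ (z + ξ t)) (deriv ξ t)⟫ with hF'
  set K : Set (EuclideanSpace ℝ (Fin 3)) := closedBall 0 (R₀ + Mξ) with hK
  have hKc : IsCompact K := isCompact_closedBall _ _
  set bound : EuclideanSpace ℝ (Fin 3) → ℝ := K.indicator fun z => M₁ * Mξ' * ‖U z‖ with hbound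
  have hbound_int : Integrable bound volume := by
    rw [hbound, integrable_indicator_iff hKc.measurableSet]
    exact ((hU.integrableOn_isCompact hKc).norm.const_mul (M₁ * Mξ'))
  have hF_meas : ∀ t : ℝ, AEStronglyMeasurable (fun z => ⟪U z, Φ (z + ξ t)⟫) volume := fun t =>
    hU.aestronglyMeasurable.inner (hΦc.comp (continuous_id.add continuous_const)).aestronglyMeasurable
  have hF_int : Integrable (fun z => ⟪U z, Φ (z + ξ τ₀)⟫) volume :=
    integrable_inner_comp_add hU hΦc hΦ.hasCompactSupport (ξ τ₀)
  have hF'_meas : AEStronglyMeasurable (F' τ₀) volume :=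
    hU.aestronglyMeasurable.inner
      ((hDΦc.comp (continuous_id.add continuous_const)).clm_apply continuous_const).aestronglyMeasurable
  have h_bound : ∀ᵐ z ∂(volume : Measure (EuclideanSpace ℝ (Fin 3))), ∀ t ∈ ball τ₀ (1 : ℝ), ‖F' t z‖ ≤ bound z := by
    refine ae_of_all _ fun z t ht => ?_
    have htI := hball t ht
    by_cases hz : z ∈ K
    · rw [hbound, indicator_of_mem hz, hF']
      calc ‖⟪U z, (fderiv ℝ Φ (z + ξ t)) (deriv ξ t)⟫‖ ≤ ‖U z‖ * ‖(fderiv ℝ Φ (z + ξ t)) (deriv ξ t)‖ := norm_inner_le_norm _ _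
        _ ≤ ‖U z‖ * (M₁ * Mξ') := by
            gcongr
            exact (ContinuousLinearMap.le_opNorm _ _).trans (mul_le_mul (hM₁ _) (hMξ' t htI) (norm_nonneg _) hM₁0)
        _ = M₁ * Mξ' * ‖U z‖ := by ring
    · have hzt : z + ξ t ∉ tsupport Φ := by
        intro hmem
        have h1 : ‖z + ξ t‖ ≤ R₀ := mem_closedBall_zero_iff.1 (hR₀ hmem)
        have h2 : ‖z‖ ≤ ‖z + ξ t‖ + ‖ξ t‖ := norm_le_add_norm_add z (ξ t)
        exact hz (mem_closedBall_zero_iff.2 (by linarith [hMξ t htI]))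
      have hD0 : fderiv ℝ Φ (z + ξ t) = 0 := by
        by_contra hne
        exact hzt (support_fderiv_subset ℝ (mem_support.2 hne))
      rw [hbound, indicator_of_notMem hz]
      simp only [hF', hD0, zero_apply, inner_zero_right, norm_zero, le_refl]
  have h_diff : ∀ᵐ z ∂(volume : Measure (EuclideanSpace ℝ (Fin 3))), ∀ t ∈ ball τ₀ (1 : ℝ),
      HasDerivAt (fun t : ℝ => ⟪U z, Φ (z + ξ t)⟫) (F' t z) t := by
    refine ae_of_all _ fun z t _ => ?_
    have hpath : HasDerivAt (fun t : ℝ => z + ξ t) (deriv ξ t) t := (hξd t).hasDerivAt.const_add z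
    have hg : HasDerivAt (fun t : ℝ => Φ (z + ξ t)) ((fderiv ℝ Φ (z + ξ t)) (deriv ξ t)) t :=
      (hΦd (z + ξ t)).hasFDerivAt.comp_hasDerivAt t hpath
    have h := (hasDerivAt_const t (U z)).inner ℝ hg
    simpa [hF'] using h
  exact (hasDerivAt_integral_of_dominated_loc_of_deriv_le (ball_mem_nhds τ₀ one_pos)
    (Eventually.of_forall hF_meas) hF_int hF'_meas h_bound hbound_int h_diff).2

/-- **Continuity of the shifted pairings** `τ ↦ ∫ ⟪U(z), Ψ(z + ξ(τ)) (c(τ))⟫ dz` (`U ∈ L¹_loc`, `Ψ` a continuous compactly supported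
operator field, `ξ`, `c` continuous). [folklore] -/
theorem continuous_integral_inner_clm_comp_add_path (hU : LocallyIntegrable U volume) (hξ : Continuous ξ)
    {Ψ : EuclideanSpace ℝ (Fin 3) → EuclideanSpace ℝ (Fin 3) →L[ℝ] EuclideanSpace ℝ (Fin 3)} (hΨ : Continuous Ψ)
    (hΨc : HasCompactSupport Ψ) {c : ℝ → EuclideanSpace ℝ (Fin 3)} (hc : Continuous c) :
    Continuous fun τ : ℝ => ∫ z, ⟪U z, Ψ (z + ξ τ) (c τ)⟫ := by
  refine continuous_iff_continuousAt.2 fun τ₀ => ?_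
  obtain ⟨M₁, hM₁⟩ := hΨ.bounded_above_of_compact_support hΨc
  have hM₁0 : 0 ≤ M₁ := (norm_nonneg _).trans (hM₁ 0)
  obtain ⟨R₀, hR₀⟩ := hΨc.isCompact.isBounded.subset_closedBall (0 : EuclideanSpace ℝ (Fin 3))
  obtain ⟨Mξ, hMξ⟩ := (isCompact_Icc (a := τ₀ - 1) (b := τ₀ + 1)).exists_bound_of_continuousOn hξ.continuousOn
  obtain ⟨Mc, hMc⟩ := (isCompact_Icc (a := τ₀ - 1) (b := τ₀ + 1)).exists_bound_of_continuousOn hc.continuousOn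
  have hMc0 : 0 ≤ Mc := (norm_nonneg _).trans (hMc τ₀ ⟨by linarith, by linarith⟩)
  have hball : ∀ t ∈ ball τ₀ (1 : ℝ), t ∈ Icc (τ₀ - 1) (τ₀ + 1) := fun t ht => by
    have h := mem_ball_iff_norm.1 ht
    rw [Real.norm_eq_abs, abs_lt] at h
    exact ⟨by linarith, by linarith⟩
  set K : Set (EuclideanSpace ℝ (Fin 3)) := closedBall 0 (R₀ + Mξ) with hK
  have hKc : IsCompact K := isCompact_closedBall _ _
  set bound : EuclideanSpace ℝ (Fin 3) → ℝ := K.indicator fun z => M₁ * Mc * ‖U z‖ with hbound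
  have hbound_int : Integrable bound volume := by
    rw [hbound, integrable_indicator_iff hKc.measurableSet]
    exact ((hU.integrableOn_isCompact hKc).norm.const_mul (M₁ * Mc))
  have hF_meas : ∀ t : ℝ, AEStronglyMeasurable (fun z => ⟪U z, Ψ (z + ξ t) (c t)⟫) volume := fun t =>
    hU.aestronglyMeasurable.inner
      ((hΨ.comp (continuous_id.add continuous_const)).clm_apply continuous_const).aestronglyMeasurable
  refine continuousAt_of_dominated (Eventually.of_forall hF_meas) ?_ hbound_int ?_
  · filter_upwards [ball_mem_nhds τ₀ one_pos] with t ht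
    refine ae_of_all _ fun z => ?_
    have htI := hball t ht
    by_cases hz : z ∈ K
    · rw [hbound, indicator_of_mem hz]
      calc ‖⟪U z, Ψ (z + ξ t) (c t)⟫‖ ≤ ‖U z‖ * ‖Ψ (z + ξ t) (c t)‖ := norm_inner_le_norm _ _
        _ ≤ ‖U z‖ * (M₁ * Mc) := by
            gcongr
            exact (ContinuousLinearMap.le_opNorm _ _).trans (mul_le_mul (hM₁ _) (hMc t htI) (norm_nonneg _) hM₁0)
        _ = M₁ * Mc * ‖U z‖ := by ring
    · have hΨ0 : Ψ (z + ξ t) = 0 := by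
        by_contra hne
        have h1 : ‖z + ξ t‖ ≤ R₀ := mem_closedBall_zero_iff.1 (hR₀ (subset_tsupport _ (mem_support.2 hne)))
        have h2 : ‖z‖ ≤ ‖z + ξ t‖ + ‖ξ t‖ := norm_le_add_norm_add z (ξ t)
        exact hz (mem_closedBall_zero_iff.2 (by linarith [hMξ t htI]))
      rw [hbound, indicator_of_notMem hz, hΨ0]
      simp
  · refine ae_of_all _ fun z => ?_
    exact (continuous_const.inner (((hΨ.comp (continuous_const.add hξ)).clm_apply hc))).continuousAt

/-- **Continuity of the quadratic shifted pairing** `τ ↦ ∫ ⟪U(z), Ψ(z + ξ(τ)) U(z)⟫ dz` (`|U|² ∈ L¹_loc`). [folklore] -/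
theorem continuous_integral_inner_clm_comp_add_path_self (hUm : AEStronglyMeasurable U volume)
    (hU2 : LocallyIntegrable (fun z => ‖U z‖ ^ 2) volume) (hξ : Continuous ξ)
    {Ψ : EuclideanSpace ℝ (Fin 3) → EuclideanSpace ℝ (Fin 3) →L[ℝ] EuclideanSpace ℝ (Fin 3)} (hΨ : Continuous Ψ)
    (hΨc : HasCompactSupport Ψ) :
    Continuous fun τ : ℝ => ∫ z, ⟪U z, Ψ (z + ξ τ) (U z)⟫ := by
  refine continuous_iff_continuousAt.2 fun τ₀ => ?_
  obtain ⟨M₁, hM₁⟩ := hΨ.bounded_above_of_compact_support hΨc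
  have hM₁0 : 0 ≤ M₁ := (norm_nonneg _).trans (hM₁ 0)
  obtain ⟨R₀, hR₀⟩ := hΨc.isCompact.isBounded.subset_closedBall (0 : EuclideanSpace ℝ (Fin 3))
  obtain ⟨Mξ, hMξ⟩ := (isCompact_Icc (a := τ₀ - 1) (b := τ₀ + 1)).exists_bound_of_continuousOn hξ.continuousOn
  have hball : ∀ t ∈ ball τ₀ (1 : ℝ), t ∈ Icc (τ₀ - 1) (τ₀ + 1) := fun t ht => by
    have h := mem_ball_iff_norm.1 ht
    rw [Real.norm_eq_abs, abs_lt] at h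
    exact ⟨by linarith, by linarith⟩
  set K : Set (EuclideanSpace ℝ (Fin 3)) := closedBall 0 (R₀ + Mξ) with hK
  have hKc : IsCompact K := isCompact_closedBall _ _
  set bound : EuclideanSpace ℝ (Fin 3) → ℝ := K.indicator fun z => M₁ * ‖U z‖ ^ 2 with hbound
  have hbound_int : Integrable bound volume := by
    rw [hbound, integrable_indicator_iff hKc.measurableSet]
    exact ((hU2.integrableOn_isCompact hKc).const_mul M₁)
  have hF_meas : ∀ t : ℝ, AEStronglyMeasurable (fun z => ⟪U z, Ψ (z + ξ t) (U z)⟫) volume := fun t =>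
    hUm.inner ((isBoundedBilinearMap_apply (𝕜 := ℝ) (E := EuclideanSpace ℝ (Fin 3))
      (F := EuclideanSpace ℝ (Fin 3))).continuous.comp_aestronglyMeasurable
        ((hΨ.comp (continuous_id.add continuous_const)).aestronglyMeasurable.prodMk hUm))
  refine continuousAt_of_dominated (Eventually.of_forall hF_meas) ?_ hbound_int ?_
  · filter_upwards [ball_mem_nhds τ₀ one_pos] with t ht
    refine ae_of_all _ fun z => ?_
    have htI := hball t ht
    by_cases hz : z ∈ K
    · rw [hbound, indicator_of_mem hz]
      calc ‖⟪U z, Ψ (z + ξ t) (U z)⟫‖ ≤ ‖U z‖ * ‖Ψ (z + ξ t) (U z)‖ := norm_inner_le_norm _ _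
        _ ≤ ‖U z‖ * (M₁ * ‖U z‖) := by
            gcongr
            exact (ContinuousLinearMap.le_opNorm _ _).trans (mul_le_mul_of_nonneg_right (hM₁ _) (norm_nonneg _))
        _ = M₁ * ‖U z‖ ^ 2 := by ring
    · have hΨ0 : Ψ (z + ξ t) = 0 := by
        by_contra hne
        have h1 : ‖z + ξ t‖ ≤ R₀ := mem_closedBall_zero_iff.1 (hR₀ (subset_tsupport _ (mem_support.2 hne)))
        have h2 : ‖z‖ ≤ ‖z + ξ t‖ + ‖ξ t‖ := norm_le_add_norm_add z (ξ t)
        exact hz (mem_closedBall_zero_iff.2 (by linarith [hMξ t htI]))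
      rw [hbound, indicator_of_notMem hz, hΨ0]
      simp
  · refine ae_of_all _ fun z => ?_
    exact (continuous_const.inner (((hΨ.comp (continuous_const.add hξ)).clm_apply continuous_const))).continuousAt



end GalileanFrames

end Summit.NavierStokesRegularity.NavierStokesRegularity.Theorems.PowerGaugeEulerLiouville
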